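import Summits.CriticalPhenomena.PercolationContinuityZ3.Theorems.PercNearOneGluingNoHeavyLowerTailSahiOneStepTwoLumpFreeReduce
import Summits.CriticalPhenomena.PercolationContinuityZ3.Theorems.PercNearOneGluingNoHeavyLowerTailSahiOneStepTwoLump
import Summits.CriticalPhenomena.PercolationContinuityZ3.Theorems.PercNearOneGluingNoHeavyLowerTailSahiOneStepFreeOdd
import HarnessLib

/-!
# TWO-SIDED LUMPING FOR EVERY PAIR OF HAMMING BALLS WITH A FREE BLOCK OF ARBITRARY DENSITIES

Support file (prover prim-ineq-prove-3 gen 53; `--supports stmt-CriticalPhenomena-4575`; memo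
`run/shared/lean/prim/prim-ineq-prove-3/PROOF-G53-TL-FREE-BLOCK.md`).  No definitions, no named facts, no sorries, no `native_decide`.

**THEOREM (`twoLump_threshold_nonneg_of_const_freeBlock`).**  Let the density vector be a constant `P ∈ (0,1)` on the block `F` and ARBITRARY in
`(0,1)` on a disjoint FREE BLOCK `E`; `T = Th_t(F ∪ E)`, `V = Th_s(F ∪ E)`, `t ≤ s`.  Then for all increasing `F`-determined `A, B`: `0 ≤ Ψ(A,B)`, i.e.
`Cov(1_A,1_B) ≥ μ(N < t)·Cov(1_A,1_B ∣ N < t) + μ(N ≥ s)·Cov(1_A,1_B ∣ N ≥ s)` (`N = N_{F∪E}`).  Gen 50's `twoLump_threshold_nonneg_of_const` is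
`E = ∅`.  Equivalently: on the UNIFORM cube `2^F`, lumping simultaneously a fuzzy lower ball and a fuzzy upper ball whose level profiles come
from independent free coordinates keeps increasing events positively correlated.

Proof: gen 50's induction (opposite compressions inside `F`, pivot `e` dominant for `A` / dominated for `B`, cross-form step
`twoLump_nonneg_of_cross`), the hulls of `B` replaced by the TWO-SIDED COSTLY-REGION REDUCTION `exists_free_reduct2` (`…TwoLumpFreeReduce`; signs of
the levels by log-concavity of `N_E`, LEMMA U), which does not increase `Ψ` and yields an `e`-FREE partner; cross terms by MONO-A
(`drift_nonneg_of_dominant`, `upperDrift_nonneg_of_dominant`) and ball monotonicity (`drift_nonpos_of_free`, `real_inter_upper_mul_le`); base layers by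
the one-sided free-block theorems `osN_threshold_nonneg_of_const_freeBlock` / `dualLump_threshold_nonneg_of_const_freeBlock`.
-/

noncomputable section

namespace Summit.CriticalPhenomena.PercolationContinuityZ3.Theorems

namespace SahiOneStep

open MeasureTheory Finset
open Literature.Probability.Percolation (DeterminedBy determinedBy_iff)
open Literature.Probability.LatticeModels (prodBernoulli prodBernoulli_harris)
open Literature.Probability.Percolation.DecisionTree (ind)
open SahiE3Sections (determinedBy_section_insert determinedBy_section_sdiff)
open scoped Classical

variable {ι : Type*} [Fintype ι]

/-- **THE TWO-SIDED LUMPING THEOREM WITH A FREE BLOCK** (memo THEOREM TL-FREE): density constant `P ∈ (0,1)` on `F`, arbitrary in `(0,1)` on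
the disjoint block `E`, levels `t ≤ s`, all increasing `F`-determined `A, B`: `0 ≤ Ψ_{Th_t(F∪E), Th_s(F∪E)}(A, B)`. [this work] -/
theorem twoLump_threshold_nonneg_of_const_freeBlock (p : ι → unitInterval) {P : ℝ} (hP0 : 0 < P) (hP1 : P < 1) (E : Finset ι)
    (hpE : ∀ i ∈ E, 0 < (p i : ℝ) ∧ (p i : ℝ) < 1) (F : Finset ι) (hFE : Disjoint F E)
    (hpF : ∀ i ∈ F, (p i : ℝ) = P) (t s : ℕ) (hts : t ≤ s) {A B : Set (Set ι)} (hA : IsUpperSet A) (hB : IsUpperSet B)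
    (hAF : DeterminedBy A (↑F : Set ι)) (hBF : DeterminedBy B (↑F : Set ι)) :
    0 ≤ (1 - (prodBernoulli p).real {ω : Set ι | t ≤ ((F ∪ E).filter (· ∈ ω)).card}) *
        (prodBernoulli p).real {ω : Set ι | s ≤ ((F ∪ E).filter (· ∈ ω)).card} *
        ((prodBernoulli p).real ({ω : Set ι | t ≤ ((F ∪ E).filter (· ∈ ω)).card} ∩ A ∩ B)
          - (prodBernoulli p).real ({ω : Set ι | s ≤ ((F ∪ E).filter (· ∈ ω)).card} ∩ A ∩ B))
    + (prodBernoulli p).real {ω : Set ι | s ≤ ((F ∪ E).filter (· ∈ ω)).card} *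
        ((prodBernoulli p).real A - (prodBernoulli p).real ({ω : Set ι | t ≤ ((F ∪ E).filter (· ∈ ω)).card} ∩ A)) *
        ((prodBernoulli p).real B - (prodBernoulli p).real ({ω : Set ι | t ≤ ((F ∪ E).filter (· ∈ ω)).card} ∩ B))
    + (1 - (prodBernoulli p).real {ω : Set ι | t ≤ ((F ∪ E).filter (· ∈ ω)).card}) *
        (prodBernoulli p).real ({ω : Set ι | s ≤ ((F ∪ E).filter (· ∈ ω)).card} ∩ A) *
        (prodBernoulli p).real ({ω : Set ι | s ≤ ((F ∪ E).filter (· ∈ ω)).card} ∩ B)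
    - (1 - (prodBernoulli p).real {ω : Set ι | t ≤ ((F ∪ E).filter (· ∈ ω)).card}) *
        (prodBernoulli p).real {ω : Set ι | s ≤ ((F ∪ E).filter (· ∈ ω)).card} *
        (prodBernoulli p).real A * (prodBernoulli p).real B := by
  induction F using Finset.induction_on generalizing t s A B with
  | empty =>
    have hagree : ∀ ω : Set ι, (∅ : Set ι) ∩ (↑(∅ : Finset ι) : Set ι) = ω ∩ ↑(∅ : Finset ι) := fun ω => by simp
    by_cases h : (∅ : Set ι) ∈ A
    · have hAu : A = Set.univ := Set.eq_univ_of_forall fun ω => ((determinedBy_iff _ _).1 hAF ∅ ω (hagree ω)).1 h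
      rw [hAu, twoLump_univ_left]
    · have hAe : A = ∅ := Set.eq_empty_of_forall_notMem fun ω hω => h (((determinedBy_iff _ _).1 hAF ∅ ω (hagree ω)).2 hω)
      rw [hAe, twoLump_empty_left]
  | insert e F heF ih =>
    have hFE' : Disjoint F E := Finset.disjoint_of_subset_left (Finset.subset_insert e F) hFE
    have heE : e ∉ E := Finset.disjoint_left.1 hFE (Finset.mem_insert_self e F)
    have hpF' : ∀ i ∈ F, (p i : ℝ) = P := fun i hi => hpF i (Finset.mem_insert_of_mem hi)
    rw [Finset.insert_union]
    set G : Finset ι := F ∪ E with hGdef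
    have heG : e ∉ G := by
      intro h
      rcases Finset.mem_union.1 h with h | h
      · exact heF h
      · exact heE h
    have hFG' : F ⊆ G := Finset.subset_union_left
    have hp01 : ∀ i ∈ G, 0 < (p i : ℝ) ∧ (p i : ℝ) < 1 := by
      intro i hi
      rcases Finset.mem_union.1 hi with hi | hi
      · rw [hpF' i hi]; exact ⟨hP0, hP1⟩
      · exact hpE i hi
    have hp01G : ∀ i ∈ insert e G, 0 < (p i : ℝ) ∧ (p i : ℝ) < 1 := by
      intro i hi
      rcases Finset.mem_insert.1 hi with rfl | hi
      · rw [hpF i (Finset.mem_insert_self i F)]; exact ⟨hP0, hP1⟩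
      · exact hp01 i hi
    have hFG : (↑(insert e F) : Set ι) ⊆ ↑(insert e G) := by
      intro i hi
      simp only [Finset.coe_insert, Set.mem_insert_iff, Finset.mem_coe, hGdef, Finset.mem_union] at hi ⊢
      tauto
    have hKS : insert e F ⊆ insert e G := Finset.insert_subset_insert e hFG'
    have hpR : ∀ i ∈ insert e G \ insert e F, 0 < (p i : ℝ) ∧ (p i : ℝ) < 1 := fun i hi => hp01G i (Finset.mem_sdiff.1 hi).1
    cases t with
    | zero => rw [twoLump_zero_left]
    | succ t =>
      obtain ⟨s, rfl⟩ : ∃ s', s = s' + 1 := ⟨s - 1, by omega⟩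
      have hts' : t ≤ s := by omega
      by_cases hsbig : (insert e G).card < s + 1
      · rw [threshold_eq_empty_of_card_lt (insert e G) hsbig]
        simp
      push Not at hsbig
      have heG' : e ∈ insert e G := Finset.mem_insert_self e G
      have heEF : e ∈ insert e F := Finset.mem_insert_self e F
      -- base layer `s + 1 = #(insert e G)`: the one-sided free-block theorem
      by_cases hstop : s + 1 = (insert e G).card
      · by_cases hAne : A = ∅
        · subst hAne
          simp
        by_cases hBne : B = ∅
        · subst hBne
          simp
        have hUA : {ω : Set ι | s + 1 ≤ ((insert e G).filter (· ∈ ω)).card} ∩ A = {ω : Set ι | s + 1 ≤ ((insert e G).filter (· ∈ ω)).card} :=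
          Set.inter_eq_left.2 (hstop ▸ threshold_card_subset hA (hAF.mono hFG) (Set.nonempty_iff_ne_empty.2 hAne))
        have hUB : {ω : Set ι | s + 1 ≤ ((insert e G).filter (· ∈ ω)).card} ∩ B = {ω : Set ι | s + 1 ≤ ((insert e G).filter (· ∈ ω)).card} :=
          Set.inter_eq_left.2 (hstop ▸ threshold_card_subset hB (hBF.mono hFG) (Set.nonempty_iff_ne_empty.2 hBne))
        have hos := osN_threshold_nonneg_of_const_freeBlock p hP0 hP1 E hpE (insert e F) hFE hpF (t + 1) hA hB hAF hBF
        rw [Finset.insert_union, osN_ind_ind] at hos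
        have hu : 0 ≤ (prodBernoulli p).real {ω : Set ι | s + 1 ≤ ((insert e G).filter (· ∈ ω)).card} := measureReal_nonneg
        have key : (1 - (prodBernoulli p).real {ω : Set ι | t + 1 ≤ ((insert e G).filter (· ∈ ω)).card}) *
                (prodBernoulli p).real {ω : Set ι | s + 1 ≤ ((insert e G).filter (· ∈ ω)).card} *
                ((prodBernoulli p).real ({ω : Set ι | t + 1 ≤ ((insert e G).filter (· ∈ ω)).card} ∩ A ∩ B)
                  - (prodBernoulli p).real ({ω : Set ι | s + 1 ≤ ((insert e G).filter (· ∈ ω)).card} ∩ A ∩ B))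
            + (prodBernoulli p).real {ω : Set ι | s + 1 ≤ ((insert e G).filter (· ∈ ω)).card} *
                ((prodBernoulli p).real A - (prodBernoulli p).real ({ω : Set ι | t + 1 ≤ ((insert e G).filter (· ∈ ω)).card} ∩ A)) *
                ((prodBernoulli p).real B - (prodBernoulli p).real ({ω : Set ι | t + 1 ≤ ((insert e G).filter (· ∈ ω)).card} ∩ B))
            + (1 - (prodBernoulli p).real {ω : Set ι | t + 1 ≤ ((insert e G).filter (· ∈ ω)).card}) *
                (prodBernoulli p).real ({ω : Set ι | s + 1 ≤ ((insert e G).filter (· ∈ ω)).card} ∩ A) *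
                (prodBernoulli p).real ({ω : Set ι | s + 1 ≤ ((insert e G).filter (· ∈ ω)).card} ∩ B)
            - (1 - (prodBernoulli p).real {ω : Set ι | t + 1 ≤ ((insert e G).filter (· ∈ ω)).card}) *
                (prodBernoulli p).real {ω : Set ι | s + 1 ≤ ((insert e G).filter (· ∈ ω)).card} *
                (prodBernoulli p).real A * (prodBernoulli p).real B
            = (prodBernoulli p).real {ω : Set ι | s + 1 ≤ ((insert e G).filter (· ∈ ω)).card} *
              ((prodBernoulli p).real ({ω : Set ι | t + 1 ≤ ((insert e G).filter (· ∈ ω)).card} ∩ A) *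
                  (prodBernoulli p).real ({ω : Set ι | t + 1 ≤ ((insert e G).filter (· ∈ ω)).card} ∩ B)
                + (1 - (prodBernoulli p).real {ω : Set ι | t + 1 ≤ ((insert e G).filter (· ∈ ω)).card}) *
                  (prodBernoulli p).real ({ω : Set ι | t + 1 ≤ ((insert e G).filter (· ∈ ω)).card} ∩ A ∩ B)
                + (prodBernoulli p).real {ω : Set ι | t + 1 ≤ ((insert e G).filter (· ∈ ω)).card} * (prodBernoulli p).real A * (prodBernoulli p).real B
                - (prodBernoulli p).real ({ω : Set ι | t + 1 ≤ ((insert e G).filter (· ∈ ω)).card} ∩ A) * (prodBernoulli p).real B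
                - (prodBernoulli p).real ({ω : Set ι | t + 1 ≤ ((insert e G).filter (· ∈ ω)).card} ∩ B) * (prodBernoulli p).real A) := by
          rw [hUA, hUB]; ring
        rw [key]
        exact mul_nonneg hu hos
      have hsF : s + 1 ≤ G.card := by rw [Finset.card_insert_of_notMem heG] at hsbig hstop; omega
      have hcoe : (↑(insert e F) : Set ι) \ {e} = ↑F := by
        ext i
        simp only [Set.mem_sdiff, Finset.coe_insert, Set.mem_insert_iff, Finset.mem_coe, Set.mem_singleton_iff]
        constructor
        · rintro ⟨h | h, hne⟩
          · exact absurd h hne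
          · exact h
        · intro h
          exact ⟨Or.inr h, fun hie => heF (hie ▸ h)⟩
      -- base layer `t + 1 = 1`: the dual free-block theorem
      rcases Nat.eq_zero_or_pos t with rfl | htpos
      · by_cases hAu : A = Set.univ
        · subst hAu; rw [twoLump_univ_left]
        by_cases hBu : B = Set.univ
        · subst hBu
          have key : (1 - (prodBernoulli p).real {ω : Set ι | 0 + 1 ≤ ((insert e G).filter (· ∈ ω)).card}) *
                (prodBernoulli p).real {ω : Set ι | s + 1 ≤ ((insert e G).filter (· ∈ ω)).card} *
                ((prodBernoulli p).real ({ω : Set ι | 0 + 1 ≤ ((insert e G).filter (· ∈ ω)).card} ∩ A ∩ Set.univ)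
                  - (prodBernoulli p).real ({ω : Set ι | s + 1 ≤ ((insert e G).filter (· ∈ ω)).card} ∩ A ∩ Set.univ))
            + (prodBernoulli p).real {ω : Set ι | s + 1 ≤ ((insert e G).filter (· ∈ ω)).card} *
                ((prodBernoulli p).real A - (prodBernoulli p).real ({ω : Set ι | 0 + 1 ≤ ((insert e G).filter (· ∈ ω)).card} ∩ A)) *
                ((prodBernoulli p).real Set.univ - (prodBernoulli p).real ({ω : Set ι | 0 + 1 ≤ ((insert e G).filter (· ∈ ω)).card} ∩ Set.univ))
            + (1 - (prodBernoulli p).real {ω : Set ι | 0 + 1 ≤ ((insert e G).filter (· ∈ ω)).card}) *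
                (prodBernoulli p).real ({ω : Set ι | s + 1 ≤ ((insert e G).filter (· ∈ ω)).card} ∩ A) *
                (prodBernoulli p).real ({ω : Set ι | s + 1 ≤ ((insert e G).filter (· ∈ ω)).card} ∩ Set.univ)
            - (1 - (prodBernoulli p).real {ω : Set ι | 0 + 1 ≤ ((insert e G).filter (· ∈ ω)).card}) *
                (prodBernoulli p).real {ω : Set ι | s + 1 ≤ ((insert e G).filter (· ∈ ω)).card} *
                (prodBernoulli p).real A * (prodBernoulli p).real Set.univ = 0 := by
            simp only [Set.inter_univ, probReal_univ]; ring
          rw [key]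
        have hT1X : ∀ X : Set (Set ι), IsUpperSet X → DeterminedBy X (↑(insert e G) : Set ι) → X ≠ Set.univ →
            {ω : Set ι | 0 + 1 ≤ ((insert e G).filter (· ∈ ω)).card} ∩ X = X := by
          intro X hX hXG hXu
          refine Set.inter_eq_right.2 fun ω hω => ?_
          simp only [Set.mem_setOf_eq]
          by_contra h
          exact hXu (eq_univ_of_mem_of_filter_card_eq_zero hX hXG hω (by omega))
        have eA := hT1X A hA (hAF.mono hFG) hAu
        have eB := hT1X B hB (hBF.mono hFG) hBu
        have hdual := dualLump_threshold_nonneg_of_const_freeBlock p hP0 hP1 E hpE (insert e F) hFE hpF (s + 1) hA hB hAF hBF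
        rw [Finset.insert_union] at hdual
        have ediff : (prodBernoulli p).real ((A ∩ B) \ {ω : Set ι | s + 1 ≤ ((insert e G).filter (· ∈ ω)).card}) =
            (prodBernoulli p).real (A ∩ B) - (prodBernoulli p).real ({ω : Set ι | s + 1 ≤ ((insert e G).filter (· ∈ ω)).card} ∩ A ∩ B) := by
          have h := measureReal_inter_add_sdiff (μ := prodBernoulli p) (s := A ∩ B)
            (t := {ω : Set ι | s + 1 ≤ ((insert e G).filter (· ∈ ω)).card}) MeasurableSet.of_discrete
          have hc : A ∩ B ∩ {ω : Set ι | s + 1 ≤ ((insert e G).filter (· ∈ ω)).card} =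
              {ω : Set ι | s + 1 ≤ ((insert e G).filter (· ∈ ω)).card} ∩ A ∩ B := by
            ext ω; simp only [Set.mem_inter_iff]; tauto
          rw [hc] at h
          linarith
        rw [ediff, Set.inter_comm A {ω : Set ι | s + 1 ≤ ((insert e G).filter (· ∈ ω)).card},
          Set.inter_comm B {ω : Set ι | s + 1 ≤ ((insert e G).filter (· ∈ ω)).card}] at hdual
        have hl : 0 ≤ 1 - (prodBernoulli p).real {ω : Set ι | 0 + 1 ≤ ((insert e G).filter (· ∈ ω)).card} := sub_nonneg.2 measureReal_le_one
        have key : (1 - (prodBernoulli p).real {ω : Set ι | 0 + 1 ≤ ((insert e G).filter (· ∈ ω)).card}) *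
                (prodBernoulli p).real {ω : Set ι | s + 1 ≤ ((insert e G).filter (· ∈ ω)).card} *
                ((prodBernoulli p).real ({ω : Set ι | 0 + 1 ≤ ((insert e G).filter (· ∈ ω)).card} ∩ A ∩ B)
                  - (prodBernoulli p).real ({ω : Set ι | s + 1 ≤ ((insert e G).filter (· ∈ ω)).card} ∩ A ∩ B))
            + (prodBernoulli p).real {ω : Set ι | s + 1 ≤ ((insert e G).filter (· ∈ ω)).card} *
                ((prodBernoulli p).real A - (prodBernoulli p).real ({ω : Set ι | 0 + 1 ≤ ((insert e G).filter (· ∈ ω)).card} ∩ A)) *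
                ((prodBernoulli p).real B - (prodBernoulli p).real ({ω : Set ι | 0 + 1 ≤ ((insert e G).filter (· ∈ ω)).card} ∩ B))
            + (1 - (prodBernoulli p).real {ω : Set ι | 0 + 1 ≤ ((insert e G).filter (· ∈ ω)).card}) *
                (prodBernoulli p).real ({ω : Set ι | s + 1 ≤ ((insert e G).filter (· ∈ ω)).card} ∩ A) *
                (prodBernoulli p).real ({ω : Set ι | s + 1 ≤ ((insert e G).filter (· ∈ ω)).card} ∩ B)
            - (1 - (prodBernoulli p).real {ω : Set ι | 0 + 1 ≤ ((insert e G).filter (· ∈ ω)).card}) *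
                (prodBernoulli p).real {ω : Set ι | s + 1 ≤ ((insert e G).filter (· ∈ ω)).card} *
                (prodBernoulli p).real A * (prodBernoulli p).real B
            = (1 - (prodBernoulli p).real {ω : Set ι | 0 + 1 ≤ ((insert e G).filter (· ∈ ω)).card}) *
              ((prodBernoulli p).real {ω : Set ι | s + 1 ≤ ((insert e G).filter (· ∈ ω)).card} *
                  ((prodBernoulli p).real (A ∩ B) - (prodBernoulli p).real ({ω : Set ι | s + 1 ≤ ((insert e G).filter (· ∈ ω)).card} ∩ A ∩ B))
                + (prodBernoulli p).real ({ω : Set ι | s + 1 ≤ ((insert e G).filter (· ∈ ω)).card} ∩ A) *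
                  (prodBernoulli p).real ({ω : Set ι | s + 1 ≤ ((insert e G).filter (· ∈ ω)).card} ∩ B)
                - (prodBernoulli p).real {ω : Set ι | s + 1 ≤ ((insert e G).filter (· ∈ ω)).card} * (prodBernoulli p).real A * (prodBernoulli p).real B) := by
          rw [eA, eB]; ring
        rw [key]
        exact mul_nonneg hl hdual
      -- main step: `1 ≤ t`, `s + 1 ≤ #G`; inner induction on the compression potential
      have hT : (prodBernoulli p).real {ω : Set ι | t + 1 ≤ ((insert e G).filter (· ∈ ω)).card} < 1 := real_threshold_lt_one p (insert e G) hp01G (t + 1) (by omega)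
      have hV : 0 < (prodBernoulli p).real {ω : Set ι | s + 1 ≤ ((insert e G).filter (· ∈ ω)).card} := real_threshold_pos p (insert e G) hp01G hsbig
      suffices key : ∀ (m : ℕ) (A B : Set (Set ι)), IsUpperSet A → IsUpperSet B →
          DeterminedBy A (↑(insert e F) : Set ι) → DeterminedBy B (↑(insert e F) : Set ι) →
          #((insert e F).powerset.filter fun S : Finset ι => (((↑S : Set ι) ∈ A) ∧ e ∉ S)) +
            #((insert e F).powerset.filter fun S : Finset ι => (((↑S : Set ι) ∈ B) ∧ e ∈ S)) = m →
          0 ≤ (1 - (prodBernoulli p).real {ω : Set ι | t + 1 ≤ ((insert e G).filter (· ∈ ω)).card}) *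
              (prodBernoulli p).real {ω : Set ι | s + 1 ≤ ((insert e G).filter (· ∈ ω)).card} *
              ((prodBernoulli p).real ({ω : Set ι | t + 1 ≤ ((insert e G).filter (· ∈ ω)).card} ∩ A ∩ B)
                - (prodBernoulli p).real ({ω : Set ι | s + 1 ≤ ((insert e G).filter (· ∈ ω)).card} ∩ A ∩ B))
          + (prodBernoulli p).real {ω : Set ι | s + 1 ≤ ((insert e G).filter (· ∈ ω)).card} *
              ((prodBernoulli p).real A - (prodBernoulli p).real ({ω : Set ι | t + 1 ≤ ((insert e G).filter (· ∈ ω)).card} ∩ A)) *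
              ((prodBernoulli p).real B - (prodBernoulli p).real ({ω : Set ι | t + 1 ≤ ((insert e G).filter (· ∈ ω)).card} ∩ B))
          + (1 - (prodBernoulli p).real {ω : Set ι | t + 1 ≤ ((insert e G).filter (· ∈ ω)).card}) *
              (prodBernoulli p).real ({ω : Set ι | s + 1 ≤ ((insert e G).filter (· ∈ ω)).card} ∩ A) *
              (prodBernoulli p).real ({ω : Set ι | s + 1 ≤ ((insert e G).filter (· ∈ ω)).card} ∩ B)
          - (1 - (prodBernoulli p).real {ω : Set ι | t + 1 ≤ ((insert e G).filter (· ∈ ω)).card}) *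
              (prodBernoulli p).real {ω : Set ι | s + 1 ≤ ((insert e G).filter (· ∈ ω)).card} *
              (prodBernoulli p).real A * (prodBernoulli p).real B from
        key _ A B hA hB hAF hBF rfl
      intro m
      induction m using Nat.strong_induction_on with
      | _ m ihm =>
      intro A B hA hB hAF hBF hm
      by_cases hdom : (∀ j ∈ F, ∀ ω ∈ A, e ∉ ω → j ∈ ω → (ω \ {j}) ∪ {e} ∈ A) ∧
          (∀ j ∈ F, ∀ ω ∈ B, e ∈ ω → j ∉ ω → (ω \ {e}) ∪ {j} ∈ B)
      · -- dominated pair: replace `B` by its two-sided costly-region reduction `B₂` (`e`-free) and apply the cross-form step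
        obtain ⟨hdomA, hdomB⟩ := hdom
        obtain ⟨B₂, hB₂up, hB₂F, hB₂free, hle⟩ :=
          exists_free_reduct2 p heF hKS hpR (show t + 1 ≤ s + 1 by omega) hT hV hA hB hAF hBF hdomA hdomB
        refine le_trans ?_ hle
        -- `e` dominates every coordinate of `G` for `A` (the free ones because `A` does not depend on them)
        have hdomA' : ∀ ω ∈ A, e ∉ ω → ∀ j ∈ G, j ∈ ω → (ω \ {j}) ∪ {e} ∈ A := by
          intro ω hω heω j hj hjω
          rcases Finset.mem_union.1 hj with hjF | hjE
          · exact hdomA j hjF ω hω heω hjω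
          · have hjK : j ∉ (↑(insert e F) : Set ι) := by
              rw [Finset.coe_insert, Set.mem_insert_iff, Finset.mem_coe]
              rintro (rfl | hjF)
              · exact heE hjE
              · exact Finset.disjoint_left.1 hFE' hjF hjE
            have hfree : ω \ {j} ∈ A := by
              refine mem_of_union_mem_of_determinedBy hAF hjK ?_
              have hωeq : ω \ {j} ∪ {j} = ω := by
                rw [Set.sdiff_union_self, Set.union_eq_left.2 (Set.singleton_subset_iff.2 hjω)]
              rw [hωeq]; exact hω
            exact hA Set.subset_union_left hfree
        -- the two sections of the `e`-free partner coincide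
        have hsec : {ω : Set ι | insert e ω ∈ B₂} = {ω : Set ι | ω \ {e} ∈ B₂} := Set.ext fun ω => hB₂free ω
        have hUup : IsUpperSet {ω : Set ι | ω \ {e} ∈ B₂} := isUpperSet_section_sdiff hB₂up e
        have hUG : DeterminedBy {ω : Set ι | ω \ {e} ∈ B₂} (↑G : Set ι) := (hcoe ▸ determinedBy_section_sdiff hB₂F e).mono (by
          intro i hi; exact Finset.mem_coe.2 (hFG' (Finset.mem_coe.1 hi)))
        refine twoLump_nonneg_of_cross p heG t s A B₂ ?_ ?_ ?_ ?_ ?_ ?_ ?_ ?_ ?_ ?_ ?_ ?_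
        · exact ih hFE' hpF' t s hts' (isUpperSet_section_insert hA e) (isUpperSet_section_insert hB₂up e)
            (hcoe ▸ determinedBy_section_insert hAF e) (hcoe ▸ determinedBy_section_insert hB₂F e)
        · exact ih hFE' hpF' (t + 1) (s + 1) (by omega) (isUpperSet_section_sdiff hA e) (isUpperSet_section_sdiff hB₂up e)
            (hcoe ▸ determinedBy_section_sdiff hAF e) (hcoe ▸ determinedBy_section_sdiff hB₂F e)
        · exact real_threshold_lt_one p G hp01 t htpos
        · exact real_threshold_lt_one p G hp01 (t + 1) (by omega)
        · exact real_threshold_pos p G hp01 (by omega)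
        · exact real_threshold_pos p G hp01 hsF
        · exact measureReal_mono (section_sdiff_subset_section_insert hA e)
        · exact measureReal_mono (section_sdiff_subset_section_insert hB₂up e)
        · have h := drift_nonneg_of_dominant p heG (show t ≤ G.card by omega) hp01 hA (hAF.mono hFG) hdomA'
          rw [section_insert_threshold heG, section_sdiff_threshold heG] at h
          exact h
        · have h := drift_nonpos_of_free p heG t hB₂up (hB₂F.mono hFG) hB₂free
          rw [section_insert_threshold heG, section_sdiff_threshold heG] at h
          exact h
        · have h := upperDrift_nonneg_of_dominant p heG hp01 hA (hAF.mono hFG) hdomA' s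
          rw [Set.inter_comm {ω : Set ι | ω \ {e} ∈ A}, Set.inter_comm {ω : Set ι | insert e ω ∈ A}] at h
          exact h
        · rw [hsec, Set.inter_comm _ {ω : Set ι | ω \ {e} ∈ B₂}, Set.inter_comm _ {ω : Set ι | ω \ {e} ∈ B₂}]
          have h := real_inter_upper_mul_le p G hUup hUG s
          nlinarith [h]
      · -- a trade fails: compress along that pair of coordinates; the potential drops
        have hex : ∃ j ∈ F, (∃ ω ∈ A, e ∉ ω ∧ j ∈ ω ∧ (ω \ {j}) ∪ {e} ∉ A) ∨ (∃ ω ∈ B, e ∈ ω ∧ j ∉ ω ∧ (ω \ {e}) ∪ {j} ∉ B) := by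
          rw [not_and_or] at hdom
          rcases hdom with h | h
          · push Not at h
            obtain ⟨j, hj, ω, hω, heω, hjω, hno⟩ := h
            exact ⟨j, hj, Or.inl ⟨ω, hω, heω, hjω, hno⟩⟩
          · push Not at h
            obtain ⟨j, hj, ω, hω, heω, hjω, hno⟩ := h
            exact ⟨j, hj, Or.inr ⟨ω, hω, heω, hjω, hno⟩⟩
        obtain ⟨j, hjF, hwit⟩ := hex
        have hej : e ≠ j := fun h => heF (h ▸ hjF)
        have hjG : j ∈ insert e F := Finset.mem_insert_of_mem hjF
        have hpej : p e = p j := Subtype.ext (by rw [hpF e heEF, hpF j hjG])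
        obtain ⟨CA, hCAdef⟩ : ∃ CA : Set (Set ι), CA = {ω : Set ι | (ω ∈ A ∧ {x : ι | Equiv.swap e j x ∈ ω} ∈ A) ∨
          (e ∈ ω ∧ j ∉ ω ∧ (ω ∈ A ∨ {x : ι | Equiv.swap e j x ∈ ω} ∈ A))} := ⟨_, rfl⟩
        obtain ⟨CB, hCBdef⟩ : ∃ CB : Set (Set ι), CB = {ω : Set ι | (ω ∈ B ∧ {x : ι | Equiv.swap e j x ∈ ω} ∈ B) ∨
          (j ∈ ω ∧ e ∉ ω ∧ (ω ∈ B ∨ {x : ι | Equiv.swap e j x ∈ ω} ∈ B))} := ⟨_, rfl⟩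
        have hCA : ∀ ω : Set ι, ω ∈ CA ↔ (ω ∈ A ∧ {x : ι | Equiv.swap e j x ∈ ω} ∈ A) ∨
            (e ∈ ω ∧ j ∉ ω ∧ (ω ∈ A ∨ {x : ι | Equiv.swap e j x ∈ ω} ∈ A)) := fun ω => by rw [hCAdef]; exact Iff.rfl
        have hCB : ∀ ω : Set ι, ω ∈ CB ↔ (ω ∈ B ∧ {x : ι | Equiv.swap e j x ∈ ω} ∈ B) ∨
            (j ∈ ω ∧ e ∉ ω ∧ (ω ∈ B ∨ {x : ι | Equiv.swap e j x ∈ ω} ∈ B)) := fun ω => by rw [hCBdef]; exact Iff.rfl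
        have hCB' : ∀ ω : Set ι, ω ∈ CB ↔ (ω ∈ B ∧ {x : ι | Equiv.swap j e x ∈ ω} ∈ B) ∨
            (j ∈ ω ∧ e ∉ ω ∧ (ω ∈ B ∨ {x : ι | Equiv.swap j e x ∈ ω} ∈ B)) := by
          intro ω; rw [Equiv.swap_comm j e]; exact hCB ω
        have hCAup : IsUpperSet CA := isUpperSet_of_compress hej hA hCA
        have hCBup : IsUpperSet CB := isUpperSet_of_compress hej.symm hB hCB'
        have hCAG : DeterminedBy CA (↑(insert e F) : Set ι) := determinedBy_of_compress heEF hjG hAF hCA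
        have hCBG : DeterminedBy CB (↑(insert e F) : Set ι) := determinedBy_of_compress hjG heEF hBF hCB'
        have hsubA := filter_pat_compress_subset (G := insert e F) hCA
        have hsubB := filter_pat_compress_subset' (G := insert e F) hCB
        have hlt : #((insert e F).powerset.filter fun S : Finset ι => (((↑S : Set ι) ∈ CA) ∧ e ∉ S)) +
            #((insert e F).powerset.filter fun S : Finset ι => (((↑S : Set ι) ∈ CB) ∧ e ∈ S)) < m := by
          rcases hwit with ⟨ω, hωA, heω, hjω, hno⟩ | ⟨ω, hωB, heω, hjω, hno⟩
          · have hS₀e : e ∉ ((↑((insert e F).filter (· ∈ ω)) : Set ι)) := fun h => by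
              rw [Finset.mem_coe, Finset.mem_filter] at h; exact heω h.2
            have hS₀j : j ∈ ((↑((insert e F).filter (· ∈ ω)) : Set ι)) := by
              rw [Finset.mem_coe, Finset.mem_filter]; exact ⟨hjG, hjω⟩
            have hS₀A : (insert e F).filter (· ∈ ω) ∈ (insert e F).powerset.filter (fun S : Finset ι => (((↑S : Set ι) ∈ A) ∧ e ∉ S)) := by
              rw [Finset.mem_filter]
              exact ⟨Finset.mem_powerset.2 (Finset.filter_subset _ _), (coe_filter_mem_iff hAF ω).2 hωA,
                fun h => heω (Finset.mem_filter.1 h).2⟩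
            have hS₀C : (insert e F).filter (· ∈ ω) ∉ (insert e F).powerset.filter (fun S : Finset ι => (((↑S : Set ι) ∈ CA) ∧ e ∉ S)) := by
              intro h
              rw [Finset.mem_filter] at h
              rcases (hCA _).1 h.2.1 with ⟨_, hσ⟩ | ⟨he', _, _⟩
              · rw [swapSet_eq_trade hS₀e hS₀j] at hσ
                have htr := trade_inter_eq (coe_filter_inter_eq (insert e F) ω) j e
                exact hno (((determinedBy_iff _ _).1 hAF _ _ htr).1 hσ)
              · exact hS₀e he'
            have h1 := Finset.card_lt_card ((Finset.ssubset_iff_of_subset hsubA).2 ⟨_, hS₀A, hS₀C⟩)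
            have h2 := Finset.card_le_card hsubB
            omega
          · have hS₀e : e ∈ ((↑((insert e F).filter (· ∈ ω)) : Set ι)) := by
              rw [Finset.mem_coe, Finset.mem_filter]; exact ⟨heEF, heω⟩
            have hS₀j : j ∉ ((↑((insert e F).filter (· ∈ ω)) : Set ι)) := fun h => by
              rw [Finset.mem_coe, Finset.mem_filter] at h; exact hjω h.2
            have hS₀B : (insert e F).filter (· ∈ ω) ∈ (insert e F).powerset.filter (fun S : Finset ι => (((↑S : Set ι) ∈ B) ∧ e ∈ S)) := by
              rw [Finset.mem_filter]
              exact ⟨Finset.mem_powerset.2 (Finset.filter_subset _ _), (coe_filter_mem_iff hBF ω).2 hωB,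
                Finset.mem_filter.2 ⟨heEF, heω⟩⟩
            have hS₀C : (insert e F).filter (· ∈ ω) ∉ (insert e F).powerset.filter (fun S : Finset ι => (((↑S : Set ι) ∈ CB) ∧ e ∈ S)) := by
              intro h
              rw [Finset.mem_filter] at h
              rcases (hCB _).1 h.2.1 with ⟨_, hσ⟩ | ⟨_, he', _⟩
              · rw [swapSet_eq_trade' hS₀e hS₀j] at hσ
                have htr := trade_inter_eq (coe_filter_inter_eq (insert e F) ω) e j
                exact hno (((determinedBy_iff _ _).1 hBF _ _ htr).1 hσ)
              · exact he' hS₀e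
            have h1 := Finset.card_le_card hsubA
            have h2 := Finset.card_lt_card ((Finset.ssubset_iff_of_subset hsubB).2 ⟨_, hS₀B, hS₀C⟩)
            omega
        calc (0 : ℝ) ≤ (1 - (prodBernoulli p).real {ω : Set ι | t + 1 ≤ ((insert e G).filter (· ∈ ω)).card}) *
                  (prodBernoulli p).real {ω : Set ι | s + 1 ≤ ((insert e G).filter (· ∈ ω)).card} *
                  ((prodBernoulli p).real ({ω : Set ι | t + 1 ≤ ((insert e G).filter (· ∈ ω)).card} ∩ CA ∩ CB)
                    - (prodBernoulli p).real ({ω : Set ι | s + 1 ≤ ((insert e G).filter (· ∈ ω)).card} ∩ CA ∩ CB))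
              + (prodBernoulli p).real {ω : Set ι | s + 1 ≤ ((insert e G).filter (· ∈ ω)).card} *
                  ((prodBernoulli p).real CA - (prodBernoulli p).real ({ω : Set ι | t + 1 ≤ ((insert e G).filter (· ∈ ω)).card} ∩ CA)) *
                  ((prodBernoulli p).real CB - (prodBernoulli p).real ({ω : Set ι | t + 1 ≤ ((insert e G).filter (· ∈ ω)).card} ∩ CB))
              + (1 - (prodBernoulli p).real {ω : Set ι | t + 1 ≤ ((insert e G).filter (· ∈ ω)).card}) *
                  (prodBernoulli p).real ({ω : Set ι | s + 1 ≤ ((insert e G).filter (· ∈ ω)).card} ∩ CA) *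
                  (prodBernoulli p).real ({ω : Set ι | s + 1 ≤ ((insert e G).filter (· ∈ ω)).card} ∩ CB)
              - (1 - (prodBernoulli p).real {ω : Set ι | t + 1 ≤ ((insert e G).filter (· ∈ ω)).card}) *
                  (prodBernoulli p).real {ω : Set ι | s + 1 ≤ ((insert e G).filter (· ∈ ω)).card} *
                  (prodBernoulli p).real CA * (prodBernoulli p).real CB := ihm _ hlt CA CB hCAup hCBup hCAG hCBG rfl
          _ ≤ _ := twoLump_compress_le p heG' (Finset.mem_insert_of_mem (hFG' hjF)) hpej (show t + 1 ≤ s + 1 by omega)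
                (hAF.mono hFG) (hBF.mono hFG) hCA hCB

end SahiOneStep

end Summit.CriticalPhenomena.PercolationContinuityZ3.Theorems
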